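import Mathlib.Analysis.Convex.SimplicialComplex.Basic
import Mathlib.Topology.LocallyFinite
import Literature.Analysis.Convexity.Secant
import HarnessLib

/-!
# Simplexwise affine (PL) maps on a geometric simplicial complex

Given a finite geometric simplicial complex `K` in a finite-dimensional real normed space `W`
and arbitrary vertex data `g : W → V`, the **simplexwise affine interpolation** `plMap K g` is
the map which on each closed simplex of `K` is the affine map agreeing with `g` at the vertices
(the *secant map* of `g`, Munkres (1966), 9.1; the *linear extension of a vertex map*,
Rourke–Sanderson (1972), 2.15).  We prove it is well defined — the interpolants of two simplices
agree on the closed common face (`affine_eqOn_convexHull_of_forall_eq`) — so that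
`plMap_eqOn_interp` / `exists_affineMap_eqOn_plMap` hold on *every* closed simplex, that it
agrees with `g` on the vertices (`plMap_apply_of_mem`), and that it is continuous on the
underlying space (`continuousOn_plMap`).  Also: the underlying space of a finite complex is
compact (`isCompact_space_of_finite`) and a map continuous on each closed simplex is continuous
on the underlying space (`continuousOn_space_of_forall`).
No named facts are introduced. [folklore]
-/

open Set Function

noncomputable section

namespace Literature.Analysis.Convexity

section Affine

variable {W V : Type*} [NormedAddCommGroup W] [NormedSpace ℝ W] [NormedAddCommGroup V]
  [NormedSpace ℝ V]

/-- Two affine maps agreeing on a finite set agree on its convex hull. [folklore] -/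
theorem affine_eqOn_convexHull_of_forall_eq {t : Finset W} {A B : W →ᵃ[ℝ] V}
    (h : ∀ v ∈ t, A v = B v) : EqOn A B (convexHull ℝ (t : Set W)) := by
  intro x hx
  obtain ⟨w, -, hw1, hwx⟩ := Finset.mem_convexHull'.1 hx
  rw [← hwx, affineMap_apply_sum_smul (g := A) (fun v _ => rfl) hw1,
    affineMap_apply_sum_smul (g := B) (fun v _ => rfl) hw1]
  exact Finset.sum_congr rfl fun v hv => by rw [h v hv]

end Affine

section PLMap

variable {W : Type*} [NormedAddCommGroup W] [NormedSpace ℝ W] [FiniteDimensional ℝ W]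
  {V : Type*} [NormedAddCommGroup V] [NormedSpace ℝ V]

/-- The affine interpolant of the vertex data `g` on an affinely independent configuration
(a choice of affine map agreeing with `g` on `t`, `exists_affineMap_eqOn`). [folklore] -/
def interp (t : Finset W) (ht : AffineIndependent ℝ ((↑) : t → W)) (g : W → V) : W →ᵃ[ℝ] V :=
  Classical.choose (exists_affineMap_eqOn ht g)

/-- The interpolant agrees with the data on the vertices. [folklore] -/
theorem interp_apply_of_mem {t : Finset W} (ht : AffineIndependent ℝ ((↑) : t → W)) (g : W → V)
    {v : W} (hv : v ∈ t) : interp t ht g v = g v :=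
  Classical.choose_spec (exists_affineMap_eqOn ht g) v hv

/-- Interpolants of a configuration and of a sub-configuration agree on the closed simplex of the
latter. [folklore] -/
theorem interp_eqOn_of_subset {t t' : Finset W} (ht : AffineIndependent ℝ ((↑) : t → W))
    (ht' : AffineIndependent ℝ ((↑) : t' → W)) (g : W → V) (h : t' ⊆ t) :
    EqOn (interp t ht g) (interp t' ht' g) (convexHull ℝ (t' : Set W)) :=
  affine_eqOn_convexHull_of_forall_eq fun v hv => by
    rw [interp_apply_of_mem ht g (h hv), interp_apply_of_mem ht' g hv]

variable (K : Geometry.SimplicialComplex ℝ W) (g : W → V)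

open Classical in
/-- **The simplexwise affine interpolation** of vertex data `g` on the complex `K`: on a point of
the underlying space, the interpolant of (some) closed simplex containing it; `g` elsewhere.
[folklore] -/
def plMap : W → V := fun x =>
  if h : ∃ s ∈ K.faces, x ∈ convexHull ℝ (s : Set W) then
    interp h.choose (K.indep h.choose_spec.1) g x
  else g x

variable {K g}

/-- **Well-definedness.** On every closed simplex of `K`, `plMap K g` is the interpolant of that
simplex. [folklore] -/
theorem plMap_eqOn_interp {s : Finset W} (hs : s ∈ K.faces) :
    EqOn (plMap K g) (interp s (K.indep hs) g) (convexHull ℝ (s : Set W)) := by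
  classical
  intro x hx
  have h : ∃ s ∈ K.faces, x ∈ convexHull ℝ (s : Set W) := ⟨s, hs, hx⟩
  rw [plMap, dif_pos h]
  -- the chosen simplex `s'` and `s` meet in a common face containing `x`
  set s' := h.choose with hs'
  have hs'K : s' ∈ K.faces := h.choose_spec.1
  have hxs' : x ∈ convexHull ℝ (s' : Set W) := h.choose_spec.2
  have hxi : x ∈ convexHull ℝ (↑(s' ∩ s) : Set W) := by
    rw [Finset.coe_inter]
    exact K.inter_subset_convexHull hs'K hs ⟨hxs', hx⟩
  have hne : (s' ∩ s).Nonempty := by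
    by_contra h0
    rw [Finset.not_nonempty_iff_eq_empty] at h0
    rw [h0] at hxi
    simp at hxi
  have hi : s' ∩ s ∈ K.faces := K.down_closed hs'K Finset.inter_subset_left hne
  rw [interp_eqOn_of_subset (K.indep hs'K) (K.indep hi) g Finset.inter_subset_left hxi,
    interp_eqOn_of_subset (K.indep hs) (K.indep hi) g Finset.inter_subset_right hxi]

/-- On every closed simplex `plMap K g` agrees with an affine map. [folklore] -/
theorem exists_affineMap_eqOn_plMap {s : Finset W} (hs : s ∈ K.faces) :
    ∃ A : W →ᵃ[ℝ] V, EqOn (plMap K g) A (convexHull ℝ (s : Set W)) ∧ ∀ v ∈ s, A v = g v :=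
  ⟨interp s (K.indep hs) g, plMap_eqOn_interp hs, fun _ hv => interp_apply_of_mem _ g hv⟩

/-- `plMap K g` agrees with `g` on the vertices. [folklore] -/
theorem plMap_apply_of_mem {s : Finset W} (hs : s ∈ K.faces) {v : W} (hv : v ∈ s) :
    plMap K g v = g v := by
  rw [plMap_eqOn_interp hs (subset_convexHull ℝ _ hv), interp_apply_of_mem _ g hv]

/-- Off the underlying space `plMap K g = g`. [folklore] -/
theorem plMap_apply_of_notMem_space {x : W} (hx : x ∉ K.space) : plMap K g x = g x := by
  have h : ¬ ∃ s ∈ K.faces, x ∈ convexHull ℝ (s : Set W) := fun ⟨s, hs, hxs⟩ =>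
    hx (K.convexHull_subset_space hs hxs)
  rw [plMap, dif_neg h]

/-- Values of `plMap` on a closed simplex as convex combinations of vertex values. [folklore] -/
theorem plMap_sum_smul {s : Finset W} (hs : s ∈ K.faces) {w : W → ℝ} (hw0 : ∀ v ∈ s, 0 ≤ w v)
    (hw1 : ∑ v ∈ s, w v = 1) : plMap K g (∑ v ∈ s, w v • v) = ∑ v ∈ s, w v • g v := by
  have hx : ∑ v ∈ s, w v • v ∈ convexHull ℝ (s : Set W) :=
    (convex_convexHull ℝ _).sum_mem hw0 hw1 fun v hv => subset_convexHull ℝ _ hv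
  rw [plMap_eqOn_interp hs hx]
  exact affineMap_apply_sum_smul (fun v hv => interp_apply_of_mem _ g hv) hw1

end PLMap

/-! ### Topology of finite complexes -/

section Topology

variable {W : Type*} [NormedAddCommGroup W] [NormedSpace ℝ W] {X : Type*} [TopologicalSpace X]

/-- The underlying space of a finite complex is compact. [folklore] -/
theorem isCompact_space_of_finite {K : Geometry.SimplicialComplex ℝ W} (hfin : K.faces.Finite) :
    IsCompact K.space :=
  hfin.isCompact_biUnion fun s _ => s.finite_toSet.isCompact_convexHull ℝ

/-- The underlying space of a finite complex is closed. [folklore] -/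
theorem isClosed_space_of_finite {K : Geometry.SimplicialComplex ℝ W} (hfin : K.faces.Finite) :
    IsClosed K.space :=
  hfin.isClosed_biUnion fun s _ => s.finite_toSet.isClosed_convexHull ℝ

/-- A map continuous on each closed simplex of a finite complex is continuous on the underlying
space. [folklore] -/
theorem continuousOn_space_of_forall {K : Geometry.SimplicialComplex ℝ W} (hfin : K.faces.Finite)
    {f : W → X} (hf : ∀ s ∈ K.faces, ContinuousOn f (convexHull ℝ (s : Set W))) :
    ContinuousOn f K.space := by
  have : K.space = ⋃ s : K.faces, convexHull ℝ ((s : Finset W) : Set W) := by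
    simp only [Geometry.SimplicialComplex.space, biUnion_eq_iUnion]
  rw [this]
  haveI : Finite K.faces := hfin.to_subtype
  exact (locallyFinite_of_finite _).continuousOn_iUnion
    (fun s => s.1.finite_toSet.isClosed_convexHull ℝ) fun s => hf s.1 s.2

variable [FiniteDimensional ℝ W] {V : Type*} [NormedAddCommGroup V] [NormedSpace ℝ V]

/-- `plMap K g` is continuous on the underlying space of a finite complex. [folklore] -/
theorem continuousOn_plMap {K : Geometry.SimplicialComplex ℝ W} (hfin : K.faces.Finite) (g : W → V) :
    ContinuousOn (plMap K g) K.space :=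
  continuousOn_space_of_forall hfin fun s hs =>
    ((interp s (K.indep hs) g).continuous_of_finiteDimensional.continuousOn).congr
      (plMap_eqOn_interp hs)

end Topology

end Literature.Analysis.Convexity
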